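import Literature.AnabelianGeometry.EtaleTheta.LogDivisorModelTateTowerArithmetic
import Literature.AnabelianGeometry.EtaleTheta.TemperedFrobenioidOfGaloisCoveringTateTower

/-!
# [EtTh] Def. 3.6 (ii) / Ex. 3.9 at the ARITHMETIC Tate tower: a tempered Frobenioid over the constructed
# Def. 3.3 (iii) data of a model with genuine constant field (port of abc-iut-w6-d048's rank-one-point engine)

S. Mochizuki, *The étale theta function …*, Publ. RIMS **45** (2009) [MochizukiEtTh2009], §3, Def. 3.3 (iii) / Rmk. 3.3.1
(PRIMS PDF p.73), Def. 3.6 (i)–(ii) (pp.76–77), Ex. 3.9 (p.81) [cite: MochizukiEtTh2009, Def 3.6 p.77].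

CLASS (b) INSTANCE (abc-iut cell, W6 seat d058 lineage, gen 3; L2-lead R448 «Prop34Const/Cor3.8(iii) port at
TateTowerArith — GO as a self-named sequel»).  abc-iut-w6-d048's generic NON-VACUITY engine
`TemperedFrobenioid.RankOnePoint A ⟹ TemperedFrobenioid.ofRankOnePoint` (p444230) was instantiated at the Tate tower
SKELETON (`TateTowerFrd`, p446077: constants `⟨ϖ⟩ ≅ ℤ`, no field).  Here it is instantiated at the ARITHMETIC Tate
tower `TateTowerArith.Datum.model/action D` (p450534: constants a genuine valued field `L/K`, Galois group
`ℤ × Aut(L/K)`), reusing the skeleton's divisor bookkeeping (`TateTowerFrd.val/constDIV/shiftDIV_constDIV`) BY NAME: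
* `TateTowerArithFrd.phiZeroTopEquivNat D : Φ₀(G/G) ≃* ℕ` — translation-and-Galois-invariant effective divisors on the
  chain are the constant ones `n·Σ_j[F_j]` (one `Gal`-orbit of prime log-divisors, Rmk. 3.3.1);
* `TateTowerArithFrd.cnstFn D c = q^c·U^0 ∈ F₀(G/G)` — the `K`-RATIONAL constant `q^c` is `ℤ × Aut(L/K)`-invariant
  (`Datum.map_qUnit`), and `div₀(q^n) = n·Σ_j[F_j]` (`div₀_cnstFn`, from `ord q = 1`);
* **`TateTowerArithFrd.rankOnePoint D : RankOnePoint D.action`**, hence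
  **`TateTowerArithFrd.temperedFrobenioid D R S : TemperedFrobenioid (ofRlfZWeak (ofGaloisActionConnected D.action
  D.cuspLaws) hpf) (Discrete PUnit) (treeCatVocab …)`** — the `p`-adic Frobenioid of the base field `K` at the bottom of
  the arithmetic tower (Ex. 3.9 / [FrdII] Ex. 1.1), now over data whose constants ARE a valued field with
  `Gal(Z_∞/X) ↠ Aut(L/K)`; `nonempty_temperedFrobenioid(_connectedPart)`, `isFrobenioid_temperedFrobenioid_byName`;
* instantiation tokens `hBinj_tateTowerArith` / `hFinv_tateTowerArith` / `hP34Λ_tateTowerArith` (the Def. 3.6 (i) /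
  Prop. 3.4 (ii) binder theorems at `A := D.action`).
With `Datum.rat p` (p451242) every statement here is non-vacuous.  HONEST FRAMING: witness over ONE point of `D₀`
(`X` itself); a combinatorial/arithmetic consistency witness, NOT the formal-scheme tower; nothing here bears on
[IUTchIII] Cor. 3.12; no side taken; typed ≠ proved.
-/

noncomputable section

namespace Literature.AnabelianGeometry.EtaleTheta

open CategoryTheory Opposite Function Literature.AlgebraicGeometry.Frobenioids
  Literature.AnabelianGeometry.SemiGraphs LogDivisorModel LogDivisorModel.GaloisAction LogDivisorModel.TateTower

namespace TateTowerArithFrd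

open LogDivisorModel.TateTowerArith

variable {K L : Type} [Field K] [Field L] [Algebra K L] (D : Datum K L)

/-- `D₀` of the arithmetic tower at this term: the connected `ℤ × Aut(L/K)`-sets. [cite: MochizukiEtTh2009, Def 3.3 p.73] -/
abbrev D₀ (K L : Type) [Field K] [Field L] [Algebra K L] : Type 1 := (isConnectedGSet (G := Grp K L)).FullSubcategory

/-- The one-point covering `G/G` — the curve `X` itself. [cite: MochizukiEtTh2009, Def 3.3 p.73] -/
abbrev top (K L : Type) [Field K] [Field L] [Algebra K L] : D₀ K L :=
  ⟨Action.ofMulAction (Grp K L) (Grp K L ⧸ (⊤ : Subgroup (Grp K L))), isConnectedGSet_quotient ⊤⟩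

/-- Its base point. [cite: MochizukiEtTh2009, Def 3.3 p.73] -/
abbrev s₀ (K L : Type) [Field K] [Field L] [Algebra K L] : (top K L).obj.V :=
  ((1 : Grp K L) : Grp K L ⧸ (⊤ : Subgroup (Grp K L)))

/-- The Def. 3.3 (iii) data of the connected coverings of the arithmetic tower. [cite: MochizukiEtTh2009, Def 3.3 p.73] -/
abbrev dm : DivisorMonoids.{1, 0, 0} (D₀ K L) := DivisorMonoids.ofGaloisActionConnected D.action D.cuspLaws

/-- Prop. 3.4 (i) (weak-cof) for every `Φ₀(Y)` of the arithmetic tower (abc-iut-w6-d057's `isPerfFactorialCof_phiZero`).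
[cite: MochizukiEtTh2009, Prop 3.4 p.74] -/
theorem hpf (Y : (D₀ K L)ᵒᵖ) : IsPerfFactorialCof ((dm D).Φ₀.obj Y) := isPerfFactorialCof_phiZero D.action Y.unop.obj

/-! ### `Φ₀(G/G) ≅ ℕ` -/

/-- All points of `G/G` coincide. [cite: MochizukiEtTh2009, Def 3.3 p.73] -/
theorem eq_s₀ (s : (top K L).obj.V) : s = s₀ K L := by
  change @Eq (Grp K L ⧸ (⊤ : Subgroup (Grp K L))) s (s₀ K L)
  obtain ⟨a, rfl⟩ := QuotientGroup.mk_surjective s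
  exact QuotientGroup.eq.mpr (Subgroup.mem_top _)

/-- `n·Σ_j [F_j]` is an effective Cartier log-divisor of the arithmetic tower. [cite: MochizukiEtTh2009, Def 3.1 p.70] -/
theorem constDIV_mem_Divplus (n : ℕ) : (TateTowerFrd.constDIV n : D.model.DIV) ∈ D.model.Divplus :=
  ⟨trivial, fun _ => Int.natCast_nonneg n⟩

/-- The constant effective log-divisor `n·Σ_j [F_j]` as an element of `Φ₀(G/G)` (invariant under translation and under
`Aut(L/K)`, which does not move divisors). [cite: MochizukiEtTh2009, Def 3.3 p.73] -/
def constPhi (n : ℕ) : D.action.phiZero (top K L).obj :=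
  ⟨fun _ => TateTowerFrd.constDIV n, fun _ => (constDIV_mem_Divplus D) n,
    fun g _ => (TateTowerFrd.shiftDIV_constDIV (Multiplicative.toAdd g.1) n).symm⟩

/-- An invariant log-divisor takes the same value on every component. [cite: MochizukiEtTh2009, Def 3.3 p.73] -/
theorem val_apply_inr_eq (φ : D.action.phiZero (top K L).obj) (s : (top K L).obj.V) (n : ℤ) :
    TateTowerFrd.val (φ.1 s) (Sum.inr n) = TateTowerFrd.val (φ.1 (s₀ K L)) (Sum.inr 0) := by
  have h := φ.2.2 (Multiplicative.ofAdd n, 1) s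
  rw [eq_s₀ ((top K L).obj.ρ (Multiplicative.ofAdd n, 1) s), eq_s₀ s] at h
  have h' := congrArg (fun d : Multiplicative (TateTower.Idx → ℤ) => TateTowerFrd.val d (Sum.inr n)) h
  change TateTowerFrd.val (φ.1 (s₀ K L)) (Sum.inr n) =
    Multiplicative.toAdd (shiftDIV (Multiplicative.toAdd (Multiplicative.ofAdd n)) (φ.1 (s₀ K L))) (Sum.inr n) at h'
  rw [toAdd_shiftDIV, toAdd_ofAdd, shiftIdx_symm_inr, sub_self] at h'
  rw [eq_s₀ s]
  exact h'

/-- The multiplicity of `φ ∈ Φ₀(G/G)` along (any) component. [cite: MochizukiEtTh2009, Def 3.3 p.73] -/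
def multAt (φ : D.action.phiZero (top K L).obj) : ℕ := Int.toNat (TateTowerFrd.val (φ.1 (s₀ K L)) (Sum.inr 0))

/-- `φ = (multAt φ)·Σ_j [F_j]`. [cite: MochizukiEtTh2009, Def 3.3 p.73] -/
theorem eq_constPhi_multAt (φ : D.action.phiZero (top K L).obj) : φ = (constPhi D) ((multAt D) φ) := by
  refine Subtype.ext (funext fun s => Multiplicative.toAdd.injective (funext fun x => ?_))
  rcases x with c | n
  · exact c.elim
  · have h0 : (0 : ℤ) ≤ TateTowerFrd.val (φ.1 (s₀ K L)) (Sum.inr 0) := (φ.2.1 (s₀ K L)).2 (Sum.inr 0)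
    change TateTowerFrd.val (φ.1 s) (Sum.inr n) = TateTowerFrd.val (TateTowerFrd.constDIV (((multAt D) φ : ℕ) : ℤ)) (Sum.inr n)
    rw [TateTowerFrd.val_constDIV, val_apply_inr_eq, multAt, Int.toNat_of_nonneg h0]

/-- **`Φ₀(G/G) ≅ ℕ`** at the arithmetic tower: one `Gal(Z_∞/X)`-orbit of prime log-divisors (Rmk. 3.3.1).
[cite: MochizukiEtTh2009, Rmk 3.3.1 p.73] -/
def phiZeroTopEquivNat : D.action.phiZero (top K L).obj ≃* Multiplicative ℕ where
  toFun φ := Multiplicative.ofAdd ((multAt D) φ)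
  invFun n := (constPhi D) (Multiplicative.toAdd n)
  left_inv φ := by
    change (constPhi D) (Multiplicative.toAdd (Multiplicative.ofAdd ((multAt D) φ))) = φ
    rw [toAdd_ofAdd]
    exact ((eq_constPhi_multAt D) φ).symm
  right_inv n := by
    change Multiplicative.ofAdd (Int.toNat (TateTowerFrd.val
      (TateTowerFrd.constDIV ((Multiplicative.toAdd n : ℕ) : ℤ)) (Sum.inr (0 : ℤ)))) = n
    rw [TateTowerFrd.val_constDIV, Int.toNat_natCast, ofAdd_toAdd]
  map_mul' φ ψ := by
    rw [← ofAdd_add]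
    congr 1
    have hφ : (0 : ℤ) ≤ TateTowerFrd.val (φ.1 (s₀ K L)) (Sum.inr 0) := (φ.2.1 (s₀ K L)).2 _
    have hψ : (0 : ℤ) ≤ TateTowerFrd.val (ψ.1 (s₀ K L)) (Sum.inr 0) := (ψ.2.1 (s₀ K L)).2 _
    change Int.toNat (TateTowerFrd.val (φ.1 (s₀ K L)) (Sum.inr 0) + TateTowerFrd.val (ψ.1 (s₀ K L)) (Sum.inr 0)) = _
    rw [Int.toNat_add hφ hψ]
    rfl

/-! ### `n·Σ_j [F_j] = div₀(qⁿ)` with `qⁿ` a `K`-rational constant: the rank-one point -/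

/-- The action fixes the `K`-rational constants `q^c·U^0`. [cite: MochizukiEtTh2009, Def 3.3 p.73] -/
theorem act_qUnit_zpow (g : Grp K L) (c : ℤ) : D.act g (D.qUnit ^ c, 1) = (D.qUnit ^ c, 1) := by
  refine Prod.ext ?_ rfl
  rw [Datum.act_fst, toAdd_one, zero_mul, neg_zero, zpow_zero, mul_one, map_zpow, Datum.map_qUnit]

/-- The constant function `q^c` on the point `G/G`, an element of `B₀(G/G)`. [cite: MochizukiEtTh2009, Def 3.3 p.73] -/
def cnstFn (c : ℤ) : D.action.bZero (top K L).obj :=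
  ⟨fun _ => (D.qUnit ^ c, 1), fun _ => trivial, fun g _ => ((act_qUnit_zpow D) g c).symm⟩

/-- `q^c` is a constant (lies in `F₀(G/G)`). [cite: MochizukiEtTh2009, Def 3.3 p.73] -/
theorem cnstFn_mem_fZero (c : ℤ) : (cnstFn D) c ∈ D.action.fZero (top K L).obj := fun _ => ⟨D.qUnit ^ c, rfl⟩

/-- `div₀(qⁿ) = n·Σ_j [F_j]` (`ord q = 1`). [cite: MochizukiEtTh2009, Def 3.3 p.73] -/
theorem div₀_cnstFn (n : ℕ) :
    D.action.divZeroHom (top K L).obj ((cnstFn D) n) =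
      Algebra.GrothendieckGroup.of ((constPhi D) n : (dm D).Φ₀.obj (op (top K L))) :=
  ((D.action.divZeroHom_eq_div_iff _ _ ((constPhi D) n) 1).2 fun s => by
    change D.action.divAt (top K L).obj ((cnstFn D) n) s * 1 = TateTowerFrd.constDIV (n : ℤ)
    rw [mul_one]
    refine Multiplicative.toAdd.injective (funext fun x => ?_)
    change Multiplicative.toAdd (D.divHom (D.qUnit ^ (n : ℤ), 1)) x = TateTowerFrd.val (TateTowerFrd.constDIV (n : ℤ)) x
    rw [Datum.toAdd_divHom, TateTowerFrd.val_constDIV, Datum.ord_zpow, Datum.ord_qUnit, toAdd_one, zero_mul, add_zero,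
      mul_one]).trans (by simp only [map_one, div_one])

/-- **The rank-one point of the arithmetic Tate tower**: `S₀ = G/G`, `Φ₀(G/G) ≅ ℕ`, every log-divisor there the divisor
of a power of the `K`-rational Tate parameter `q`. [cite: MochizukiEtTh2009, Def 3.3 p.73] -/
def rankOnePoint : TemperedFrobenioid.RankOnePoint D.action where
  S₀ := top K L
  e := (phiZeroTopEquivNat D)
  hcnst m := ⟨(cnstFn D) ((multAt D) m), (cnstFn_mem_fZero D) _, by rw [div₀_cnstFn, ← eq_constPhi_multAt]⟩

variable (R S : ((Discrete PUnit.{1})ᵒᵖ ⥤ CommMonCat.{0}) → Prop)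

/-- **A tempered Frobenioid over the constructed connected Def. 3.3 (iii) data of the ARITHMETIC Tate tower** (weak data,
monoid type `ℤ`; base `pt ↦ G/G`): the `p`-adic Frobenioid of the base field at the bottom of the tower, over data with a
genuine constant field. [cite: MochizukiEtTh2009, Def 3.6 p.77] -/
def temperedFrobenioid :
    TemperedFrobenioid (RealifiedDivisorMonoids.ofRlfZWeak (dm D) (hpf D)) (Discrete PUnit.{1})
      (treeCatVocab (Discrete PUnit.{1}) R S) :=
  TemperedFrobenioid.ofRankOnePoint D.cuspLaws (rankOnePoint D) (hpf D) R S

/-- **NON-VACUITY at the arithmetic Tate tower.** [cite: MochizukiEtTh2009, Def 3.6 p.77] -/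
theorem nonempty_temperedFrobenioid :
    Nonempty (TemperedFrobenioid (RealifiedDivisorMonoids.ofRlfZWeak
      (DivisorMonoids.ofGaloisActionConnected D.action D.cuspLaws) (hpf D))
      (Discrete PUnit.{1}) (treeCatVocab (Discrete PUnit.{1}) R S)) :=
  ⟨(temperedFrobenioid D) R S⟩

/-- Non-vacuity over print's genuine base `B^temp(Π)⁰`, every topological group `Π`. [cite: MochizukiEtTh2009, Def 3.6 p.77] -/
theorem nonempty_temperedFrobenioid_connectedPart (Γ : Type) [Group Γ] [TopologicalSpace Γ]
    (R' S' : ((ConnectedPart (BTemp Γ))ᵒᵖ ⥤ CommMonCat.{0}) → Prop) :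
    Nonempty (TemperedFrobenioid (RealifiedDivisorMonoids.ofRlfZWeak
      (DivisorMonoids.ofGaloisActionConnected D.action D.cuspLaws) (hpf D))
      (ConnectedPart (BTemp Γ)) (treeCatVocab (ConnectedPart (BTemp Γ)) R' S')) :=
  TemperedFrobenioid.nonempty_of_rankOnePoint_connectedPart D.cuspLaws (hpf D) Γ (rankOnePoint D) R' S'

/-! ### Instantiation tokens at `A := D.action` -/

/-- **«`C` IS a Frobenioid» at the arithmetic tower** (abc-iut-w5-d179's hypothesis-free theorem, instantiated).
[cite: MochizukiEtTh2009, Def 3.6 p.77] -/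
theorem isFrobenioid_temperedFrobenioid_byName : PreFrobenioid.IsFrobenioid ((temperedFrobenioid D) R S).toElem :=
  TemperedFrobenioid.isFrobenioid_ofRlfZWeak_ofGaloisActionConnected_of_isOfFSMType D.action D.cuspLaws (hpf D)
    ((temperedFrobenioid D) R S) PadicFrd.isOfFSMType_discretePUnit

/-- **`hBinj` at the arithmetic tower** (Def. 3.6 (i) binder). [cite: MochizukiEtTh2009, Def 3.6 p.76] -/
theorem hBinj_tateTowerArith {Y Y' : (D₀ K L)ᵒᵖ} (g : Y ⟶ Y') :
    Injective ((RealifiedDivisorMonoids.ofRlfZWeak (dm D) (hpf D)).BΛ.map g).hom :=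
  DivisorMonoids.ofGaloisActionConnected_ofRlfZWeak_hBinj D.action D.cuspLaws (hpf D) g

variable (R₀ R₀' : ((D₀ K L)ᵒᵖ ⥤ CommMonCat.{0}) → Prop)

/-- **`hFinv` at the arithmetic tower** (GAP G-w5d135-1 binder, a theorem here). [cite: MochizukiEtTh2009, Prop 3.4 p.74] -/
theorem hFinv_tateTowerArith (Y : (D₀ K L)ᵒᵖ)
    (b : (RealifiedDivisorMonoids.ofRlfZWeakOfProp34 (dm D) (DivisorMonoids.prop34_ofGaloisActionConnected D.action
      D.cuspLaws R₀ R₀')).BΛ.obj Y)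
    (hb : b ∈ (RealifiedDivisorMonoids.ofRlfZWeakOfProp34 (dm D) (DivisorMonoids.prop34_ofGaloisActionConnected D.action
      D.cuspLaws R₀ R₀')).FΛ Y) :
    ∃ b' ∈ (RealifiedDivisorMonoids.ofRlfZWeakOfProp34 (dm D) (DivisorMonoids.prop34_ofGaloisActionConnected D.action
      D.cuspLaws R₀ R₀')).FΛ Y, b' * b = 1 :=
  DivisorMonoids.hFinv_rlfZ_ofGaloisActionConnected D.action D.cuspLaws R₀ R₀' Y b hb

/-- **`hP34Λ` at the arithmetic tower** (GAP G-w5d124-1 binder, a theorem here). [cite: MochizukiEtTh2009, Prop 3.4 p.74] -/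
theorem hP34Λ_tateTowerArith (Y : (D₀ K L)ᵒᵖ)
    (b : (RealifiedDivisorMonoids.ofRlfZWeakOfProp34 (dm D) (DivisorMonoids.prop34_ofGaloisActionConnected D.action
      D.cuspLaws R₀ R₀')).BΛ.obj Y)
    (x : (RealifiedDivisorMonoids.ofRlfZWeakOfProp34 (dm D) (DivisorMonoids.prop34_ofGaloisActionConnected D.action
      D.cuspLaws R₀ R₀')).ΦR.obj Y)
    (hbx : (RealifiedDivisorMonoids.ofRlfZWeakOfProp34 (dm D) (DivisorMonoids.prop34_ofGaloisActionConnected D.action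
      D.cuspLaws R₀ R₀')).divΛ Y b = Algebra.GrothendieckGroup.of x) :
    b ∈ (RealifiedDivisorMonoids.ofRlfZWeakOfProp34 (dm D) (DivisorMonoids.prop34_ofGaloisActionConnected D.action
      D.cuspLaws R₀ R₀')).FΛ Y :=
  DivisorMonoids.hP34Λ_rlfZ_ofGaloisActionConnected D.action D.cuspLaws R₀ R₀' Y b x hbx

end TateTowerArithFrd

end Literature.AnabelianGeometry.EtaleTheta

end
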